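import Literature.NumberTheory.Automorphic.ParabolicGLExactProofs
import Literature.NumberTheory.Automorphic.AdmissibleSubquotient
import HarnessLib

/-!
# "`i_c` preserves finite length": reduction to irreducible inducing data

First step of the proof of the named fact `Representation.isFiniteLength_parabolicIndGL`
(parabolic induction on `GL_n(F)` preserves finite length; Bernstein–Zelevinsky 1977, Thm. 2.8
with Remark 2.10; Zelevinsky 1980, Prop. 1.4), as printed in Zelevinsky 1980, p. 171, proof of
Prop. 1.4: "Since the functor `i_{α,β}` is exact, it is sufficient to prove that `i_{α,β}(ω)` has
finite length for irreducible `ω`." Formally (`Representation.isFiniteLength_parabolicIndGL_of_irreducible`):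
if `i_c ω` has finite length over `ℂ[GL_n(F)]` for every *irreducible admissible* representation
`ω` of the Levi `Π_a GL_{n_a}(F)` on a space in a fixed universe, then `i_c σ` has finite length
for every admissible `σ` of finite length over the group algebra of the Levi (spaces in the same
universe); `Representation.isFiniteLength_parabolicIndGL_of_forall_irreducible` restates this with
the named fact as conclusion. Proof: induction on a composition series of `σ` (Mathlib
`IsFiniteLength`); for `N ≤ σ` with `σ ⧸ N` simple, `N` and `σ ⧸ N` are admissible
(`AdmissibleSubquotient`), `i_c N` has finite length by induction, `i_c (σ ⧸ N)` by hypothesis,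
and `0 → i_c N → i_c σ → i_c (σ ⧸ N)` is exact (`ParabolicGLExactProofs`:
`parabolicIndGLMap_injective`, `parabolicIndGLMap_exact`), so `i_c σ` has finite length
(`Representation.isFiniteLength_of_range_eq_ker`).

Programme note (seat `…parabolicI-c16feaad7f-0`). The remaining steps towards the fact planned in
this seat are: `i_c ω` is finitely generated for irreducible admissible `ω`
(`SmoothInductionBigCell`, `SmoothInductionCyclic` + a `GL_n` big-cell datum), and "finitely
generated admissible representations of `GL_n(F)` have finite length" via the uniform-level
criterion `AdmissibleFiniteLength`, Jacquet functors, Harish-Chandra's cuspidality criterion on the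
Levi and the splitting of compact representations (Bernstein–Zelevinsky 1976, §§2.4, 3.2–3.3;
Bernstein–Zelevinsky 1977, 2.14 (2)) — not the Geometrical Lemma 2.12.

Theorems only; no definitions, no named facts.

## References

* A. V. Zelevinsky, *Induced representations of reductive `p`-adic groups II*, Ann. Sci. ÉNS 13
  (1980), Prop. 1.1 (a) and the proof of Prop. 1.4, p. 171.
* I. N. Bernstein, A. V. Zelevinsky, *Induced representations of reductive `p`-adic groups I*,
  Ann. Sci. ÉNS 10 (1977), Prop. 2.3 (a), p. 446; Thm. 2.8 and Remark 2.10, p. 448.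
-/

noncomputable section

open scoped MonoidAlgebra

namespace Representation

/-! ### From `Function.Exact` to `range = ker` for intertwining maps -/

section ExactDictionary

variable {k G V W U : Type*} [CommRing k] [Group G]
  [AddCommGroup V] [Module k V] [AddCommGroup W] [Module k W] [AddCommGroup U] [Module k U]
  {ρ : Representation k G V} {σ : Representation k G W} {τ : Representation k G U}

/-- `Function.Exact f g` for intertwining maps means `range f = ker g` as subrepresentations. [folklore] -/
theorem IntertwiningMap.range_eq_ker_of_exact {f : ρ.IntertwiningMap σ} {g : σ.IntertwiningMap τ}
    (h : Function.Exact f g) : f.range = g.ker := by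
  ext w
  change w ∈ f.range ↔ w ∈ g.ker
  rw [IntertwiningMap.mem_range, IntertwiningMap.mem_ker]
  exact ⟨fun ⟨v, hv⟩ => (h w).2 ⟨v, hv⟩, fun hw => (h w).1 hw⟩

end ExactDictionary

section SubQuotientExact

open Literature.RepresentationTheory.FiniteGroups

variable {k G V : Type*} [Field k] [Group G] [AddCommGroup V] [Module k V]
  {ρ : Representation k G V}

/-- The inclusion of a subrepresentation followed by the quotient map is exact. [folklore] -/
theorem exact_subtypeIntertwiningMap_mkQ (N : Subrepresentation ρ) :
    Function.Exact (Subrepresentation.subtypeIntertwiningMap N) N.mkQ := by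
  intro v
  rw [Subrepresentation.mkQ_eq_zero_iff]
  constructor
  · intro hv
    exact ⟨⟨v, hv⟩, rfl⟩
  · rintro ⟨w, rfl⟩
    exact w.2

end SubQuotientExact

/-! ### The reduction -/

section Reduction

open Literature.NumberTheory.Automorphic Literature.RepresentationTheory.FiniteGroups
  Literature.RepresentationTheory.Semisimple

universe u

variable (F : Type*) [Field F] [ValuativeRel F] [TopologicalSpace F] [IsNonarchimedeanLocalField F]
  {n : Type*} [Fintype n] [DecidableEq n] {α : Type*} [LinearOrder α] (c : n → α)
  [LocallyCompactSpace (standardParabolicGL F c)]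

/-- `i_c` of a zero representation is zero, hence of finite length. [folklore] -/
theorem isFiniteLength_parabolicIndGL_of_subsingleton {W : Type*} [AddCommGroup W] [Module ℂ W]
    [Subsingleton W] (σ : Representation ℂ (Π a, GL {i // c i = a} F) W) :
    IsFiniteLength (MonoidAlgebra ℂ (GL n F)) (parabolicIndGL F c σ).asModule := by
  haveI : Subsingleton (parabolicIndGL F c σ).asModule :=
    ⟨fun f g => SmoothInd.ext (funext fun _ => Subsingleton.elim _ _)⟩
  exact IsFiniteLength.of_subsingleton

/-- **Reduction to irreducible inducing data** (Zelevinsky 1980, proof of Prop. 1.4, first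
sentence: "since the functor `i` is exact it is sufficient to prove that `i(ω)` has finite length
for irreducible `ω`"; Bernstein–Zelevinsky 1977, Prop. 2.3 (a)). If `i_c ω` has finite length over
`ℂ[GL_n(F)]` for every irreducible admissible representation `ω` of the Levi `Π_a GL_{n_a}(F)` on a
space in the universe `u`, then `i_c σ` has finite length for every admissible representation `σ`
of finite length (over the group algebra of the Levi) on a space in `u`: induction on a
composition series of `σ`; sub- and quotient representations of `σ` are admissible, and
`0 → i_c N → i_c σ → i_c (σ ⧸ N)` is exact. [cite: Zelevinsky1980, Prop. 1.4 (proof), p. 171] -/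
theorem isFiniteLength_parabolicIndGL_of_irreducible
    (hirr : ∀ {W : Type u} [AddCommGroup W] [Module ℂ W]
      (ω : Representation ℂ (Π a, GL {i // c i = a} F) W), ω.IsIrreducible → ω.IsAdmissible →
        IsFiniteLength (MonoidAlgebra ℂ (GL n F)) (parabolicIndGL F c ω).asModule)
    {W : Type u} [AddCommGroup W] [Module ℂ W] (σ : Representation ℂ (Π a, GL {i // c i = a} F) W)
    (hσ : σ.IsAdmissible)
    (hσ' : IsFiniteLength (MonoidAlgebra ℂ (Π a, GL {i // c i = a} F)) σ.asModule) :
    IsFiniteLength (MonoidAlgebra ℂ (GL n F)) (parabolicIndGL F c σ).asModule := by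
  suffices key : ∀ (M : Type u) [AddCommGroup M] [Module (MonoidAlgebra ℂ (Π a, GL {i // c i = a} F)) M],
      IsFiniteLength (MonoidAlgebra ℂ (Π a, GL {i // c i = a} F)) M →
      ∀ {W : Type u} [AddCommGroup W] [Module ℂ W] (σ : Representation ℂ (Π a, GL {i // c i = a} F) W),
        σ.IsAdmissible → (σ.asModule ≃ₗ[MonoidAlgebra ℂ (Π a, GL {i // c i = a} F)] M) →
          IsFiniteLength (MonoidAlgebra ℂ (GL n F)) (parabolicIndGL F c σ).asModule from
    key σ.asModule hσ' σ hσ (LinearEquiv.refl _ _)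
  intro M _ _ hM
  induction hM with
  | @of_subsingleton M _ _ _ =>
    intro W _ _ σ _ e
    haveI : Subsingleton W := (σ.asModuleEquiv.symm.toEquiv.trans e.toEquiv).subsingleton
    exact isFiniteLength_parabolicIndGL_of_subsingleton F c σ
  | @of_simple_quotient M _ _ S _ hS ih =>
    intro W _ _ σ hσ e
    -- pull the submodule `S ≤ M` back to a subrepresentation `N ≤ σ`
    set S' : Submodule (MonoidAlgebra ℂ (Π a, GL {i // c i = a} F)) σ.asModule :=
      S.comap (e : σ.asModule →ₗ[MonoidAlgebra ℂ (Π a, GL {i // c i = a} F)] M) with hS'def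
    set N : Subrepresentation σ := Subrepresentation.ofSubmodule' S' with hNdef
    -- the subrepresentation: admissible, of finite length `= length S`, so by induction
    have hsub : IsFiniteLength (MonoidAlgebra ℂ (GL n F))
        (parabolicIndGL F c N.toRepresentation).asModule := by
      refine ih N.toRepresentation (hσ.toRepresentation N) ?_
      exact (Literature.RepresentationTheory.Semisimple.Subrepresentation.asModuleEquiv N).trans
        (LinearEquiv.ofSubmodule' e S)
    -- the quotient: irreducible and admissible, so `i_c` of it has finite length by hypothesis
    haveI : IsSimpleModule (MonoidAlgebra ℂ (Π a, GL {i // c i = a} F)) (σ.asModule ⧸ N.asSubmodule) :=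
      IsSimpleModule.congr (Submodule.Quotient.equiv S' S e
        (Submodule.map_comap_eq_of_surjective e.surjective S))
    have hquot : IsFiniteLength (MonoidAlgebra ℂ (GL n F))
        (parabolicIndGL F c N.quotientRep).asModule :=
      hirr N.quotientRep (N.isIrreducible_quotientRep_of_isSimpleModule) (hσ.quotientRep N)
    -- glue by exactness of `i_c`
    exact isFiniteLength_of_range_eq_ker
      (parabolicIndGLMap F c (Subrepresentation.subtypeIntertwiningMap N))
      (parabolicIndGLMap F c N.mkQ)
      (IntertwiningMap.range_eq_ker_of_exact (parabolicIndGLMap_exact F c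
        (Subrepresentation.subtypeIntertwiningMap_injective N) (exact_subtypeIntertwiningMap_mkQ N)))
      hsub hquot

omit [LocallyCompactSpace (standardParabolicGL F c)] in
/-- The reduction specialised to the named fact: if `i_c ω` has finite length for every
irreducible admissible `ω` of the Levi (spaces in universe `u`), then
`Representation.isFiniteLength_parabolicIndGL F c` holds at universe `u`.
[cite: Zelevinsky1980, Prop. 1.4 (proof), p. 171] -/
theorem isFiniteLength_parabolicIndGL_of_forall_irreducible
    (hirr : ∀ [LocallyCompactSpace (standardParabolicGL F c)] {W : Type u} [AddCommGroup W]
      [Module ℂ W] (ω : Representation ℂ (Π a, GL {i // c i = a} F) W),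
        ω.IsIrreducible → ω.IsAdmissible →
          IsFiniteLength (MonoidAlgebra ℂ (GL n F)) (parabolicIndGL F c ω).asModule) :
    isFiniteLength_parabolicIndGL.{_, _, _, u} F c := by
  intro _ W _ _ σ hσ hσ'
  exact isFiniteLength_parabolicIndGL_of_irreducible F c hirr σ hσ hσ'

end Reduction

end Representation
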